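import Summits.BirchSwinnertonDyer.BirchSwinnertonDyer.Theorems.PrintCf2RubinValueTwoLinePinInnerSpecialization
import HarnessLib

/-!
# M-LINE-PIN (crux `PrintCf2RubinValueTwo.MainConjClauseAtSplitTwoQuad`, stmt-BirchSwinnertonDyer-24086), (C4′): the specialisation
# `T₂ ↦ 0` of a two-variable characteristic ideal under INNER `T₂`-REGULARITY instead of S3n′ —
# `(ch_{Λ₂} X)(T₁, 0) = ch_Λ(X ⧸ T₂ X)` when `X[T₂] = 0`

Cell `bsd-print-cf2`, LEAD seat `bsd-line-cf2-p1` g14 (prover-bsd-line-cf2-p1-g14-0), registering seat of the M-LINE-PIN skeleton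
(planner g19 spec `bsd-print-cf2-plan/M-LINE-PIN-SKELETON-SPEC-g19.md`). `--supports stmt-BirchSwinnertonDyer-24086 --as helper`,
Theses-free. HONEST FRAMING: pure module algebra over `Λ₂ = ℤ_p⟦T₂⟧⟦T₁⟧`; the twin of cf2c-w8 g3's (C4)
`LinePinControl.map_mapConstantCoeff_charIdeal_eq_of_pseudoNull_finite_of_ne_bot` (p697168) with the S3n′ hypothesis
«every pseudo-null submodule is finite» REPLACED by inner regularity «`(C T) • x = 0 → x = 0`» (no `T₂`-torsion) — the junk factor
`ch_Λ(X[T₂])` of the Herbrand specialisation is then `1` on the nose (-w4 g10's `TwoVar.map_constantCoeff_charIdeal_eq`). WHY (LEAD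
ruling R-REG₂ for crux 20368, 2026-08-29, applied to the research child 24086): S3n′ (route-C item 24037) has only a CONDITIONAL
proof (Greenberg 2016 Prop. 4.1.1 + Tate's Euler characteristic, p684823), while `T`-regularity statements have a fact-free road
(Leopoldt at `v` = Brumer, PROVED; -w2 g14 memo `S3N-FACTFREE-w2g14.md`); for the INNER variable the road is the OUTER one applied
to the SWAPPED datum (`LinePinControl.exists_dualData₂_swap`, p696880, + `XRegPinned.xRegular_char_of_locSurj`, p701365, for the
pair `(κ₂, κ₁; γ₂, γ₁)`). Nothing here concerns elliptic curves or measures; no summit statement is proved by this seat; BSD is not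
proved by any of this. THEOREMS ONLY (no definition, no named fact, no `sorry`).

* `map_constantCoeff_charIdeal_eq_of_xRegular_of_ne_bot` — OUTER form: `X` f.g. torsion over `Λ₂`, `(ch X)(0, T₂) ≠ 0`, `X[T₁] = 0`
  ⟹ `(charIdeal Λ₂ X).map constantCoeff = charIdeal Λ (X ⧸ T₁ X)` (one line over `TwoVar.map_constantCoeff_charIdeal_eq` +
  `TwoVarSpecialization.exists_constantCoeff_ne_zero_of_map_charIdeal_ne_bot`).
* **`map_mapConstantCoeff_charIdeal_eq_of_xRegularInner_of_ne_bot`** — INNER form for `D : DualData₂ κ₁ κ₂ M v̄ γ₁ γ₂`: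
  `D.X` f.g. torsion, `(ch D.X)(T₁, 0) ≠ 0`, `D.X[T₂] = 0` ⟹ `(charIdeal Λ₂ D.X).map (map constantCoeff) = charIdeal Λ (D.X ⧸ T₂ D.X)`
  for the first slot's `Λ`-structure («`T ↦ T₁`», `Module.compHom` along `map C`) — p697168's proof with the transport of S3n′ replaced by
  the transport of regularity along the swap (`σ (C T) = T`).
presearch: Delbourgo 2008 Ch. X Lemma 10.5; Skinner–Urban 2014 Cor. 3.2.9 (ii); Bourbaki AC VII §4.5 — tree theorems; assembly.
beyond-print theorem: no.

References: [Delbourgo2008] Ch. X Lemma 10.5; [SkinnerUrban2014] Cor. 3.2.9 (ii); [BourbakiAC5to7] VII §4.5; [Washington1997] §13.2.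
-/

noncomputable section

open scoped Classical Pointwise

-- the summit namespace `Summit.BirchSwinnertonDyer.BirchSwinnertonDyer` repeats the problem name by design (D-0017)
set_option linter.dupNamespace false
set_option autoImplicit false

open Literature.NumberTheory.EllipticCurves Literature.NumberTheory.EllipticCurves.Module Literature.NumberTheory.GaloisRepresentations
  Summit.BirchSwinnertonDyer.BirchSwinnertonDyer.Theorems.PrintCf2

universe u

namespace Summit.BirchSwinnertonDyer.BirchSwinnertonDyer.Theorems.PrintCf2.LinePinControl

open NumberField IsDedekindDomain Field

/-! ## §1. Outer form -/

section Outer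

variable (p : ℕ) [Fact p.Prime] (X : Type*) [AddCommGroup X] [Module (IwasawaAlgebra₂ p) X] [Module.Finite (IwasawaAlgebra₂ p) X]

/-- **Specialisation `T₁ ↦ 0` under `T₁`-regularity**: `X` f.g. torsion over `Λ₂`, `(charIdeal Λ₂ X).map constantCoeff ≠ ⊥`, and
`X[T₁] = 0` ⟹ `(charIdeal Λ₂ X).map constantCoeff = charIdeal Λ (X ⧸ T₁ X)` (constants structure `T ↦ T₂`).
[cite: Delbourgo2008, Ch. X Lemma 10.5] [cite: SkinnerUrban2014, Cor. 3.2.9 (ii)] -/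
theorem map_constantCoeff_charIdeal_eq_of_xRegular_of_ne_bot (htors : Module.IsTorsion (IwasawaAlgebra₂ p) X)
    (hne : (charIdeal (IwasawaAlgebra₂ p) X).map (PowerSeries.constantCoeff (R := IwasawaAlgebra p)) ≠ ⊥)
    (hX : ∀ m : X, (PowerSeries.X : IwasawaAlgebra₂ p) • m = 0 → m = 0) :
    letI : Module (IwasawaAlgebra p) (QuotSMulTop (PowerSeries.X : IwasawaAlgebra₂ p) X) :=
      Module.compHom _ (PowerSeries.C (R := IwasawaAlgebra p))
    (charIdeal (IwasawaAlgebra₂ p) X).map (PowerSeries.constantCoeff (R := IwasawaAlgebra p)) =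
      charIdeal (IwasawaAlgebra p) (QuotSMulTop (PowerSeries.X : IwasawaAlgebra₂ p) X) :=
  SignedBaseChangeAcDivSpecialization.TwoVar.map_constantCoeff_charIdeal_eq p X
    (TwoVarSpecialization.exists_constantCoeff_ne_zero_of_map_charIdeal_ne_bot p X htors hne) hX

end Outer

/-! ## §2. Inner form for a two-variable dual datum, by swapping the pair -/

section Inner

variable {K : Type u} [Field K] [NumberField K] {p : ℕ} [Fact p.Prime] {κ₁ κ₂ : ZpExtension K p}
  {M : Type u} [AddCommGroup M] [DistribMulAction (absoluteGaloisGroup K) M] [TopologicalSpace M] [DiscreteTopology M]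
  {vbar : HeightOneSpectrum (𝓞 K)} {γ₁ γ₂ : absoluteGaloisGroup K}

/-- **SPECIALISATION ALONG THE INNER VARIABLE UNDER INNER REGULARITY: `(ch_{Λ₂} D.X)(T₁, 0) = ch_Λ(D.X ⧸ T₂ D.X)`** for a
two-variable dual datum `D` with `D.X` finitely generated and torsion, `(ch_{Λ₂} D.X)(T₁,0) ≠ 0` and NO `T₂`-torsion
(`(C T) • x = 0 → x = 0`); the `Λ`-structure on the `γ₂`-coinvariants `D.X ⧸ (C T) • D.X` is `Module.compHom` along
`PowerSeries.map PowerSeries.C` («`T ↦ T₁`», the first slot's line). Proof: p697168's, transporting regularity (instead of S3n′)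
along the swap `σ` (`σ (C T) = T`) and applying the OUTER theorem of §1 to the swapped datum.
[cite: Delbourgo2008, Ch. X Lemma 10.5] [cite: Washington1997, §13.2] [cite: BourbakiAC5to7, VII §4.5] -/
theorem map_mapConstantCoeff_charIdeal_eq_of_xRegularInner_of_ne_bot (D : DualData₂ κ₁ κ₂ M vbar γ₁ γ₂)
    [Module.Finite (IwasawaAlgebra₂ p) D.X] (htors : Module.IsTorsion (IwasawaAlgebra₂ p) D.X)
    (hne : (charIdeal (IwasawaAlgebra₂ p) D.X).map (PowerSeries.map (PowerSeries.constantCoeff (R := ℤ_[p]))) ≠ ⊥)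
    (hX : ∀ x : D.X, (PowerSeries.C (PowerSeries.X : IwasawaAlgebra p) : IwasawaAlgebra₂ p) • x = 0 → x = 0) :
    letI : Module (IwasawaAlgebra p) (QuotSMulTop (PowerSeries.C (PowerSeries.X : IwasawaAlgebra p) : IwasawaAlgebra₂ p) D.X) :=
      Module.compHom _ (PowerSeries.map (PowerSeries.C (R := ℤ_[p])))
    (charIdeal (IwasawaAlgebra₂ p) D.X).map (PowerSeries.map (PowerSeries.constantCoeff (R := ℤ_[p]))) =
      charIdeal (IwasawaAlgebra p) (QuotSMulTop (PowerSeries.C (PowerSeries.X : IwasawaAlgebra p) : IwasawaAlgebra₂ p) D.X) := by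
  letI instQ : Module (IwasawaAlgebra p) (QuotSMulTop (PowerSeries.C (PowerSeries.X : IwasawaAlgebra p) : IwasawaAlgebra₂ p) D.X) :=
    Module.compHom _ (PowerSeries.map (PowerSeries.C (R := ℤ_[p])))
  -- the swap and the swapped datum
  obtain ⟨σ, hσ⟩ := Literature.RingTheory.PowerSeries.exists_ringEquiv_powerSeries_swap (R := ℤ_[p])
  obtain ⟨D', e, he, hchar, htor', hT⟩ := exists_dualData₂_swap (κ₁ := κ₁) (κ₂ := κ₂) (M := M) (vbar := vbar) (γ₁ := γ₁) (γ₂ := γ₂) hσ D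
  have hsymm : ∀ (s : IwasawaAlgebra₂ p) (y : D'.X), e.symm (s • y) = σ.symm s • e.symm y :=
    SpecializationNoPseudoNull.symm_smul_of_semilinear σ e he
  -- transport of finite generation, torsion, regularity
  haveI : Module.Finite (IwasawaAlgebra₂ p) D'.X := FiniteTwist.finite_of_semilinear σ.symm e.symm hsymm inferInstance
  have htors' : Module.IsTorsion (IwasawaAlgebra₂ p) D'.X := htor' htors
  have hX' : ∀ y : D'.X, (PowerSeries.X : IwasawaAlgebra₂ p) • y = 0 → y = 0 := by
    intro y hy
    obtain ⟨x, rfl⟩ := e.surjective y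
    have hx : e ((PowerSeries.C (PowerSeries.X : IwasawaAlgebra p) : IwasawaAlgebra₂ p) • x) = 0 := by
      rw [he, swap_C_X hσ, hy]
    rw [hX x (e.injective (by rw [hx, map_zero])), map_zero]
  -- the outer line of `char D'.X = σ(char D.X)` is the inner line of `char D.X`
  have hmap : (charIdeal (IwasawaAlgebra₂ p) D'.X).map (PowerSeries.constantCoeff (R := IwasawaAlgebra p)) =
      (charIdeal (IwasawaAlgebra₂ p) D.X).map (PowerSeries.map (PowerSeries.constantCoeff (R := ℤ_[p]))) := by
    rw [hchar, Ideal.map_map, constantCoeff_comp_swap hσ]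
  have hne' : (charIdeal (IwasawaAlgebra₂ p) D'.X).map (PowerSeries.constantCoeff (R := IwasawaAlgebra p)) ≠ ⊥ := by
    rwa [hmap]
  -- the OUTER theorem for `D'`
  have hout := map_constantCoeff_charIdeal_eq_of_xRegular_of_ne_bot p D'.X htors' hne' hX'
  rw [hmap] at hout
  rw [hout]
  -- identify the `Λ`-modules `D'.X ⧸ T₁ D'.X` (via `C`, through `σ⁻¹`) and `D.X ⧸ T₂ D.X` (via `map C`)
  letI instQ' : Module (IwasawaAlgebra p) (QuotSMulTop (PowerSeries.X : IwasawaAlgebra₂ p) D'.X) :=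
    Module.compHom _ (PowerSeries.C (R := IwasawaAlgebra p))
  haveI : RingHomSurjective (σ : IwasawaAlgebra₂ p →+* IwasawaAlgebra₂ p) := ⟨σ.surjective⟩
  let eₗ : D.X →ₛₗ[(σ : IwasawaAlgebra₂ p →+* IwasawaAlgebra₂ p)] D'.X :=
    { toFun := e, map_add' := fun a b ↦ e.map_add a b, map_smul' := he }
  have hle : (PowerSeries.C (PowerSeries.X : IwasawaAlgebra p) : IwasawaAlgebra₂ p) • (⊤ : Submodule (IwasawaAlgebra₂ p) D.X) ≤
      ((PowerSeries.X : IwasawaAlgebra₂ p) • (⊤ : Submodule (IwasawaAlgebra₂ p) D'.X)).comap eₗ :=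
    fun x hx ↦ (hT x).mpr hx
  let F : QuotSMulTop (PowerSeries.C (PowerSeries.X : IwasawaAlgebra p) : IwasawaAlgebra₂ p) D.X →ₛₗ[(σ : IwasawaAlgebra₂ p →+* IwasawaAlgebra₂ p)]
      QuotSMulTop (PowerSeries.X : IwasawaAlgebra₂ p) D'.X :=
    Submodule.mapQ _ _ eₗ hle
  have hFmk : ∀ x : D.X, F (Submodule.Quotient.mk x) = Submodule.Quotient.mk (e x) := fun _ ↦ rfl
  have hFinj : Function.Injective F := by
    rw [injective_iff_map_eq_zero]
    intro q hq
    obtain ⟨x, rfl⟩ := Submodule.Quotient.mk_surjective _ q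
    rw [hFmk, Submodule.Quotient.mk_eq_zero] at hq
    exact (Submodule.Quotient.mk_eq_zero _).mpr ((hT x).mp hq)
  have hFsurj : Function.Surjective F := by
    intro q
    obtain ⟨y, rfl⟩ := Submodule.Quotient.mk_surjective _ q
    obtain ⟨x, rfl⟩ := e.surjective y
    exact ⟨Submodule.Quotient.mk x, hFmk x⟩
  -- `F` is `Λ`-linear for the two compHom structures: `σ (map C t) = C t`
  have hFlin : ∀ (t : IwasawaAlgebra p) (q : QuotSMulTop (PowerSeries.C (PowerSeries.X : IwasawaAlgebra p) : IwasawaAlgebra₂ p) D.X),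
      F (t • q) = t • F q := fun t q ↦ by
    show F ((PowerSeries.map (PowerSeries.C (R := ℤ_[p])) t) • q) = (PowerSeries.C t : IwasawaAlgebra₂ p) • F q
    rw [LinearMap.map_smulₛₗ, RingHom.coe_coe, (Literature.RingTheory.PowerSeries.swap_C_eq_map_C hσ t).2]
  let Fℓ : QuotSMulTop (PowerSeries.C (PowerSeries.X : IwasawaAlgebra p) : IwasawaAlgebra₂ p) D.X ≃ₗ[IwasawaAlgebra p]
      QuotSMulTop (PowerSeries.X : IwasawaAlgebra₂ p) D'.X :=
    { toFun := F
      map_add' := F.map_add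
      map_smul' := hFlin
      invFun := Function.surjInv hFsurj
      left_inv := fun q ↦ hFinj (Function.surjInv_eq hFsurj (F q))
      right_inv := Function.surjInv_eq hFsurj }
  exact (Literature.NumberTheory.EllipticCurves.Module.charIdeal_eq_of_linearEquiv Fℓ).symm

end Inner

end Summit.BirchSwinnertonDyer.BirchSwinnertonDyer.Theorems.PrintCf2.LinePinControl

end
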